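/-
M15f (decomp-mm-lens-5 g28) — ONE DEFLATION ROUND AT ORDER `K`: the order-`K` polar lemma as a
typed hypothesis `PolarLemmaOrder K` (proved for `K = 2` from M15b), and
`InitIsolatedFam u K y ⇒ InitIsolatedFam (u ⧺ D_μ u) (K − 1) y` under it.
-/
import Mathlib
import Summits.MatrixMultiplication.Statement
import Summits.MatrixMultiplication.MatrixMultiplication.Theorems.GraphEquationsTangentDeflation

/-!
# Graph equations — the deflation round at isolation order `K`

Supporting kernel for the crux `MultiplicityReduction` of route `GraphEquations` (stub
`BoundedOrderPurification` = BOP′, rungs `K ≥ 3`).  `GraphEquationsDeflation` (M15c) lowers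
isolation order `2 → 1` in ONE round along a coefficient field whose value at `y` is a generic
tangent vector; the only ingredient specific to `K = 2` there is the polar lemma
`exists_deflation_direction` (M15b).  Here the round is typed at every order:

* `PolarLemmaOrder K` — **the order-`K` polar lemma** (a `Prop`, hypothesis of the round): for forms
  `P_o` of degrees `d_o ≤ K` on `ℂ^σ` with `{x : P_o(x) = P_o(0) ∀ o} = {0}` there is `γ` in the
  common kernel `N` of the linear members such that the family
  `{P_o : d_o ≤ K − 1} ∪ {D_γ P_o : d_o ≥ 2}` (degrees `≤ K − 1`) again has only the trivial common
  zero.  `polarLemmaOrder_two : PolarLemmaOrder 2` is M15b.  For `K ≥ 3` it is TRUE but not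
  formalised (paper proof, recorded in the cell's NODE-g28 §2: if bad `γ` were dense in `N`, a
  `ℂ*`-stable component of the incidence `{(x, γ) : x ∈ V(P_{≤ K−1}) ∖ 0, J_{≥2}(x)γ = 0}` would
  dominate `N`, forcing `rank (J_{≥2}(x)|_N) ≤ dim Y − 1` on its base cone `Y ⊆ N`; but
  `(P_o)_{d_o ≥ 2}` restricts to a FINITE homogeneous map on `Y` — its zero fibre is `{0}` — with
  image of dimension `dim Y`, contradiction; the formalisation gap is dimension theory of finite maps).
* `InitIsolatedFam.deflate_of_data_order`, `InitIsolatedFam.deflate_order`,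
  `IdealInitIsolatedSet.deflate_order`, `EqSystem.IdealInitIsolatedAt.deflate_order` — under
  `PolarLemmaOrder K`: a family / ideal / test ideal initially isolated to order `K` over `y` has a
  direction `γ` (in the common kernel of its linear members) such that for EVERY coefficient field
  `μ` with `μ(y) = γ` the deflated family `u ⧺ D_μ u` (resp. any system containing the tests and
  their `D_μ`-derivatives, `EqSystem.DeflatesTo`) is initially isolated to order `K − 1` over `y`.
  Iterating with a FRESH field of the CURRENT system each round reaches order `1` after `K − 1`
  rounds (a single field iterated does not: `D_μ` of its own deflation is uncontrolled); with
  `forwardModeAD` each round multiplies cost by `≤ 4` plus the field's program, so rung `K` of BOP′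
  reduces to `PolarLemmaOrder k` (`3 ≤ k ≤ K`, true, untyped) and `K − 1` kernel fields of the
  successive systems with good values and cost `O(n^{β'})` — the order-`K` analogue of
  `UniformKernelFieldDeflation`.
* `EqSystem.IdealInitIsolatedAt.deflate_tangent_order` — as in M15e the direction can be taken in
  `ker J_C(graphPoint y)` when `E` is correct and `1 ≤ K` (the closing `example` recovers M15e's
  `deflate_tangent` from `polarLemmaOrder_two`).

Sources: Leykin–Verschelde–Zhao 2006 [doi:10.1016/j.tcs.2006.02.018] (repeated first-order
deflation), Dayton–Zeng 2005 [doi:10.1145/1073884.1073901] (number of rounds ≤ depth).  No sorry.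
-/

-- dupNamespace: forced by the nested Summit.MatrixMultiplication.MatrixMultiplication layout (D-0017)
set_option linter.dupNamespace false

noncomputable section

open scoped BigOperators

namespace Summit.MatrixMultiplication.MatrixMultiplication.Theorems.GraphEquations

open MvPolynomial Literature.Computability.AlgebraicComplexity

variable {n : ℕ}

/-! ## The order-`K` polar lemma as a typed hypothesis -/

/-- **ORDER-`K` POLAR LEMMA** (`Prop`).  For homogeneous `P_o` of degrees `d_o ≤ K` on `ℂ^σ` whose
only common "zero" (`P_o(x) = P_o(0)` for all `o`) is `x = 0`, there is `γ` killing the linear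
members such that `{P_o : d_o ≤ K − 1} ∪ {D_γ P_o : d_o ≥ 2}` has only the trivial common zero.
Intended for `K ≥ 2` (at `K = 1` the conclusion drops the linear members and the statement is
false for nonempty `σ`; `K = 0` is vacuous). -/
def PolarLemmaOrder (K : ℕ) : Prop :=
  ∀ (σ : Type) [Fintype σ] [DecidableEq σ] (T : ℕ) (P : Fin T → MvPolynomial σ ℂ) (d : Fin T → ℕ),
    (∀ o, (P o).IsHomogeneous (d o)) → (∀ o, d o ≤ K) →
    (∀ x : σ → ℂ, (∀ o, eval x (P o) = eval 0 (P o)) → x = 0) →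
    ∃ γ : σ → ℂ, (∀ o, d o = 1 → eval γ (P o) = 0) ∧
      ∀ x : σ → ℂ, (∀ o, d o ≤ K - 1 → eval x (P o) = eval 0 (P o)) →
        (∀ o, 2 ≤ d o → eval x (polarDeriv γ (P o)) = 0) → x = 0

/-- **`K = 2`** is the polar lemma of `GraphEquationsPolarLemma` (M15b). -/
theorem polarLemmaOrder_two : PolarLemmaOrder 2 := by
  intro σ _ _ T P d hP hd hiso
  obtain ⟨γ, hγN, hγ⟩ := exists_deflation_direction P d hP hd hiso
  refine ⟨γ, hγN, fun x h1 h2 => hγ x (fun o ho => ?_) (fun o ho => h2 o (by omega))⟩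
  rw [h1 o (by omega), eval_zero_of_isHomogeneous (hP o) (by omega)]

/-! ## One round at order `K` -/

/-- **DEFLATION ROUND AT ORDER `K` (explicit data).**  Under `PolarLemmaOrder K`: if `u_o = G_o(a,b;f)`
is initially isolated to order `K` over `y` with data `(ν, G)`, there is `γ` in the common kernel of
the specialised linear members such that for EVERY coefficient field `μ` with `μ(y) = γ` the family
`u ⧺ (D_μ u_o)_o` is initially isolated to order `K − 1` over `y`. -/
theorem InitIsolatedFam.deflate_of_data_order {K : ℕ} (hPL : PolarLemmaOrder K) {T : ℕ}
    {u : Fin T → MvPolynomial (GraphVars n) ℂ} {y : MatMulVars n → ℂ} (ν : Fin T → ℕ) (G : Fin T → FPoly n)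
    (hν : ∀ o, ν o ≤ K) (hG : ∀ o, substF n (G o) = u o)
    (hlow : ∀ o, ∀ j < ν o, homogeneousComponent j (G o) = 0)
    (hiso : ∀ F₀ : Fin n × Fin n → ℂ,
      (∀ o, eval F₀ (map (eval y) (homogeneousComponent (ν o) (G o))) =
          eval 0 (map (eval y) (homogeneousComponent (ν o) (G o)))) → F₀ = 0) :
    ∃ γ : Fin n × Fin n → ℂ,
      (∀ o, ν o = 1 → eval γ (map (eval y) (homogeneousComponent 1 (G o))) = 0) ∧
      ∀ μ : Fin n × Fin n → MvPolynomial (MatMulVars n) ℂ, (∀ q, eval y (μ q) = γ q) →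
        InitIsolatedFam (Fin.append u fun o => derivC μ (u o)) (K - 1) y := by
  classical
  obtain ⟨P, hPdef⟩ : ∃ P : Fin T → MvPolynomial (Fin n × Fin n) ℂ,
      P = fun o => map (eval y) (homogeneousComponent (ν o) (G o)) := ⟨_, rfl⟩
  have hP : ∀ o, (P o).IsHomogeneous (ν o) := fun o => by
    rw [hPdef]; exact (homogeneousComponent_isHomogeneous _ _).map _
  obtain ⟨γ, hγN, hγ⟩ := hPL (Fin n × Fin n) T P ν hP hν (by rw [hPdef]; exact hiso)
  refine ⟨γ, fun o ho => by have h := hγN o ho; rw [hPdef] at h; simpa only [ho] using h, fun μ hμ => ?_⟩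
  have hμ' : (fun q => eval y (μ q)) = γ := funext hμ
  refine ⟨Fin.append (fun o => min (ν o) (K - 1)) (fun o => ν o - 1),
    Fin.append G (fun o => polarDeriv μ (G o)), fun i => ?_, fun i => ?_, fun i => ?_, fun F₀ hF => ?_⟩
  · induction i using Fin.addCases with
    | left o => simp only [Fin.append_left]; exact min_le_right _ _
    | right o => simp only [Fin.append_right]; have := hν o; omega
  · induction i using Fin.addCases with
    | left o => simp only [Fin.append_left, hG]
    | right o => simp only [Fin.append_right, substF_polarDeriv, hG]
  · induction i using Fin.addCases with
    | left o =>
      intro j hj; simp only [Fin.append_left] at hj ⊢; exact hlow o j (lt_of_lt_of_le hj (min_le_left _ _))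
    | right o =>
      intro j hj; simp only [Fin.append_right] at hj ⊢
      rw [homogeneousComponent_polarDeriv, hlow o (j + 1) (by omega), polarDeriv_zero]
  · refine hγ F₀ (fun o ho => ?_) (fun o ho => ?_)
    · have h := hF (Fin.castAdd T o)
      simp only [Fin.append_left, min_eq_left ho] at h
      rw [hPdef]; exact h
    · have h := hF (Fin.natAdd T o)
      simp only [Fin.append_right] at h
      rw [show ν o - 1 = (ν o - 1 - 0) from rfl, homogeneousComponent_polarDeriv, map_polarDeriv, hμ',
        show ν o - 1 - 0 + 1 = ν o by omega] at h
      have hPo : P o = map (eval y) (homogeneousComponent (ν o) (G o)) := by rw [hPdef]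
      rw [hPo, h]
      exact eval_zero_of_isHomogeneous
        (IsHomogeneous.polarDeriv ((homogeneousComponent_isHomogeneous (ν o) (G o)).map (eval y)) γ) (by omega)

/-- **DEFLATION ROUND AT ORDER `K` (family).** -/
theorem InitIsolatedFam.deflate_order {K : ℕ} (hPL : PolarLemmaOrder K) {T : ℕ}
    {u : Fin T → MvPolynomial (GraphVars n) ℂ} {y : MatMulVars n → ℂ} (h : InitIsolatedFam u K y) :
    ∃ γ : Fin n × Fin n → ℂ, ∀ μ : Fin n × Fin n → MvPolynomial (MatMulVars n) ℂ,
      (∀ q, eval y (μ q) = γ q) → InitIsolatedFam (Fin.append u fun o => derivC μ (u o)) (K - 1) y := by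
  obtain ⟨ν, G, hν, hG, hlow, hiso⟩ := h
  obtain ⟨γ, -, hγ⟩ := InitIsolatedFam.deflate_of_data_order hPL ν G hν hG hlow hiso
  exact ⟨γ, hγ⟩

/-- **DEFLATION ROUND AT ORDER `K` (ideal).** -/
theorem IdealInitIsolatedSet.deflate_order {K : ℕ} (hPL : PolarLemmaOrder K)
    {S : Set (MvPolynomial (GraphVars n) ℂ)} {y : MatMulVars n → ℂ} (h : IdealInitIsolatedSet S K y) :
    ∃ γ : Fin n × Fin n → ℂ, ∀ μ : Fin n × Fin n → MvPolynomial (MatMulVars n) ℂ,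
      (∀ q, eval y (μ q) = γ q) → ∀ S' : Set (MvPolynomial (GraphVars n) ℂ), S ⊆ S' →
        (∀ t ∈ S, derivC μ t ∈ S') → IdealInitIsolatedSet S' (K - 1) y := by
  obtain ⟨T, u, hu, hfam⟩ := h
  obtain ⟨γ, hγ⟩ := hfam.deflate_order hPL
  refine ⟨γ, fun μ hμ S' hSS' hD => ⟨T + T, _, fun i => ?_, hγ μ hμ⟩⟩
  induction i using Fin.addCases with
  | left o => simp only [Fin.append_left]; exact Ideal.span_mono hSS' (hu o)
  | right o => simp only [Fin.append_right]; exact derivC_mem_span μ hSS' hD (hu o)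

namespace EqSystem

/-- **DEFLATION ROUND AT ORDER `K` (system).**  Under `PolarLemmaOrder K`: if the test ideal of `E` is
initially isolated to order `K` over `y`, there is `γ` such that every system containing the
`μ`-deflation of `E` for a field with `μ(y) = γ` has its test ideal initially isolated to order
`K − 1` over `y`. -/
theorem IdealInitIsolatedAt.deflate_order {K : ℕ} (hPL : PolarLemmaOrder K) {E : EqSystem n}
    {y : MatMulVars n → ℂ} (h : E.IdealInitIsolatedAt K y) :
    ∃ γ : Fin n × Fin n → ℂ, ∀ μ : Fin n × Fin n → MvPolynomial (MatMulVars n) ℂ,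
      (∀ q, eval y (μ q) = γ q) → ∀ E' : EqSystem n, E.DeflatesTo μ E' → E'.IdealInitIsolatedAt (K - 1) y := by
  obtain ⟨γ, hγ⟩ := IdealInitIsolatedSet.deflate_order hPL ((E.idealInitIsolatedAt_iff K y).mp h)
  refine ⟨γ, fun μ hμ E' hE' => (E'.idealInitIsolatedAt_iff (K - 1) y).mpr (hγ μ hμ _ ?_ ?_)⟩
  · intro t ht
    obtain ⟨j, hj, rfl⟩ := (E.mem_testSet_iff t).mp ht
    obtain ⟨j', hj', hjj'⟩ := hE'.1 j hj
    exact (E'.mem_testSet_iff _).mpr ⟨j', hj', hjj'⟩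
  · intro t ht
    obtain ⟨j, hj, rfl⟩ := (E.mem_testSet_iff t).mp ht
    obtain ⟨j', hj', hjj'⟩ := hE'.2 j hj
    exact (E'.mem_testSet_iff _).mpr ⟨j', hj', hjj'⟩

/-- **… with a TANGENT direction** (as in `GraphEquationsTangentDeflation`): for a correct system
and `1 ≤ K` the direction can be taken in `ker J_C(graphPoint y)`. -/
theorem IdealInitIsolatedAt.deflate_tangent_order {K : ℕ} (hK : 1 ≤ K) (hPL : PolarLemmaOrder K)
    {E : EqSystem n} {y : MatMulVars n → ℂ} (hE : E.Correct) (h : E.IdealInitIsolatedAt K y) :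
    ∃ γ : Fin n × Fin n → ℂ, (E.jacobianC (graphPoint y)).mulVec γ = 0 ∧
      ∀ μ : Fin n × Fin n → MvPolynomial (MatMulVars n) ℂ, (∀ q, eval y (μ q) = γ q) →
        ∀ E' : EqSystem n, E.DeflatesTo μ E' → E'.IdealInitIsolatedAt (K - 1) y := by
  obtain ⟨T, u, hu, ν, G, hν, hG, hlow, hiso⟩ := h
  obtain ⟨v, hv⟩ : ∃ v : Fin E.tests.length → MvPolynomial (GraphVars n) ℂ,
      v = fun o => E.testPoly (E.tests.get o) := ⟨_, rfl⟩
  have hν' : ∀ o, Fin.append ν (fun _ : Fin E.tests.length => 1) o ≤ K := fun o => by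
    induction o using Fin.addCases with
    | left o => simpa only [Fin.append_left] using hν o
    | right o => simpa only [Fin.append_right] using hK
  have hG' : ∀ o, substF n (Fin.append G (fun o => liftF n (v o)) o) = Fin.append u v o := fun o => by
    induction o using Fin.addCases with
    | left o => simp only [Fin.append_left, hG]
    | right o => simp only [Fin.append_right, substF_liftF]
  have hlow' : ∀ o, ∀ j < Fin.append ν (fun _ : Fin E.tests.length => 1) o,
      homogeneousComponent j (Fin.append G (fun o => liftF n (v o)) o) = 0 := fun o => by
    induction o using Fin.addCases with
    | left o => simpa only [Fin.append_left] using hlow o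
    | right o =>
      intro j hj
      simp only [Fin.append_right] at hj ⊢
      obtain rfl : j = 0 := by omega
      rw [hv]
      exact homogeneousComponent_zero_liftF_eq_zero fun x hx => hE.eval_testPoly_eq_zero hx (List.get_mem _ _)
  have hiso' : ∀ F₀ : Fin n × Fin n → ℂ,
      (∀ o, eval F₀ (map (eval y) (homogeneousComponent (Fin.append ν (fun _ : Fin E.tests.length => 1) o)
          (Fin.append G (fun o => liftF n (v o)) o))) =
        eval 0 (map (eval y) (homogeneousComponent (Fin.append ν (fun _ : Fin E.tests.length => 1) o)
          (Fin.append G (fun o => liftF n (v o)) o)))) → F₀ = 0 :=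
    fun F₀ hF => hiso F₀ fun o => by simpa only [Fin.append_left] using hF (Fin.castAdd _ o)
  obtain ⟨γ, hγN, hγ⟩ := InitIsolatedFam.deflate_of_data_order hPL _ _ hν' hG' hlow' hiso'
  refine ⟨γ, (E.jacobianC_graphPoint_mulVec_eq_zero_iff y γ).mpr fun j hj => ?_, fun μ hμ E' hD => ?_⟩
  · obtain ⟨o, ho⟩ := List.mem_iff_get.mp hj
    have h := hγN (Fin.natAdd T o) (by simp only [Fin.append_right])
    rw [Fin.append_right, hv] at h
    simpa only [ho] using h
  · have hSS' : E.testSet ⊆ E'.testSet := fun t ht => by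
      obtain ⟨j, hj, rfl⟩ := (E.mem_testSet_iff t).mp ht
      obtain ⟨j', hj', hjj'⟩ := hD.1 j hj
      exact (E'.mem_testSet_iff _).mpr ⟨j', hj', hjj'⟩
    have hDS : ∀ t ∈ E.testSet, derivC μ t ∈ E'.testSet := fun t ht => by
      obtain ⟨j, hj, rfl⟩ := (E.mem_testSet_iff t).mp ht
      obtain ⟨j', hj', hjj'⟩ := hD.2 j hj
      exact (E'.mem_testSet_iff _).mpr ⟨j', hj', hjj'⟩
    have hmem : ∀ o, Fin.append u v o ∈ Ideal.span E.testSet := fun o => by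
      induction o using Fin.addCases with
      | left o => simp only [Fin.append_left]; exact hu o
      | right o => simp only [Fin.append_right, hv]; exact Ideal.subset_span ⟨o, rfl⟩
    refine (E'.idealInitIsolatedAt_iff (K - 1) y).mpr ⟨_, _, fun i => ?_, hγ μ hμ⟩
    induction i using Fin.addCases with
    | left o => simp only [Fin.append_left]; exact Ideal.span_mono hSS' (hmem o)
    | right o => simp only [Fin.append_right]; exact derivC_mem_span μ hSS' hDS (hmem o)

end EqSystem

/- RUNG CHECK (an `example`, since the statement IS the landed `IdealInitIsolatedAt.deflate_tangent`
of M15e): with `polarLemmaOrder_two` the order-`K` round specialises to `K = 2 ↦ K − 1 = 1`. -/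
example {E : EqSystem n} {y : MatMulVars n → ℂ} (hE : E.Correct) (h : E.IdealInitIsolatedAt 2 y) :
    ∃ γ : Fin n × Fin n → ℂ, (E.jacobianC (graphPoint y)).mulVec γ = 0 ∧
      ∀ μ : Fin n × Fin n → MvPolynomial (MatMulVars n) ℂ, (∀ q, eval y (μ q) = γ q) →
        ∀ E' : EqSystem n, E.DeflatesTo μ E' → E'.IdealInitIsolatedAt 1 y :=
  EqSystem.IdealInitIsolatedAt.deflate_tangent_order (K := 2) (by norm_num) polarLemmaOrder_two hE h

end Summit.MatrixMultiplication.MatrixMultiplication.Theorems.GraphEquations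

end
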